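import Summits.RiemannHypothesis.RiemannHypothesis.Theorems.MotivicDoor.AWS.PlumbingSignature

/-!
# AWS plumbing III: truncation levels, restriction maps, Gram matrices

HONEST LABEL (verbatim on every AWS file).  One-way implication from a strengthened, prime-side-only
axiom system; the existence of such an object is NOT claimed and is the located gap; the converse
(RH ⇒ existence) is out of scope and, for this axiom system, tautological rather than informative
(HOME `AXIOM-CONTENT.md` §2; `AWS/Tautological`, `AWS/CanonicalCarrier`; REFEREE-1 B36/B39):
`Nonempty ArithmeticWeilSurface` is a restatement of RH in structure clothing, NOT evidence for RH.
Framing: lottery ticket at the motivic door; RH probability negligible; consolation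
prizes are real: a new semi-local Weil-positivity theorem, or a located gap in the Connes–Consani
programme, plus the ff-door theorem.  Nothing in this file mentions `ζ`, its zeros or
`RiemannHypothesis`: it is linear algebra over the structure `ArithmeticWeilSurface` of
`Theorems/MotivicDoorAWSStructure` (AWS sprint part (d), plumbing; seat aws-1).

## Contents (all PROVED)

* `levelLattice s` — the subgroup of `L` generated by `e₁, e₂, frob i (i ∈ s)` for a finite
  subfamily `s : Finset X.gen.ι` (the carrier search works level by level); monotonicity;
  `cycle_mem_levelLattice`;
* `levelInclusion` — the RESTRICTION (inclusion) homomorphisms `L_s →+ L_t` for `s ⊆ t`, injective,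
  FUNCTORIAL (`levelInclusion_refl`, `levelInclusion_trans`), and the level pairings `levelInter s`
  with their compatibility `levelInter_inclusion`;
* `levelSpace s ⊂ L ⊗ ℝ` — the real level spaces (finite-dimensional), `toLℝ_mem_levelSpace`
  (integral ⊂ real at each level), and `sigPos_levelSpace`: signature `(1, ·)` at EVERY level;
* `gram`, `primGram` — Gram matrices of finite families of lattice vectors; `posSemidef_neg_primGram`:
  the unconstrained level test `−primGram ⪰ 0` (for the Frobenius classes the diagonal of
  `−primGram` is `Re Q(φ_i)`, `interBC_prim_cycleℝ`, so this is the windowed Weil Gram test), and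
  `dotProduct_gram_mulVec_nonpos` (the field `hodge` verbatim for any finite index type).
-/

noncomputable section

open TensorProduct Literature.NumberTheory.LFunctions Literature.NumberTheory.ConnesConsani2019
open scoped BigOperators Matrix

namespace Summit.RiemannHypothesis.RiemannHypothesis.Theorems.MotivicDoor.AWS

namespace ArithmeticWeilSurface

variable (X : ArithmeticWeilSurface)

/-! ## 4. Truncation levels: lattices, restriction maps, real level spaces -/

/-- The classes of a level form a finite set. -/
theorem levelClasses_finite (s : Finset X.gen.ι) : (X.levelClasses s).Finite :=
  (Set.toFinite _).union (s.finite_toSet.image X.frob)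

/-- Levels are monotone in the subfamily. -/
theorem levelClasses_mono {s t : Finset X.gen.ι} (h : s ⊆ t) :
    X.levelClasses s ⊆ X.levelClasses t :=
  Set.union_subset_union_right _ (Set.image_mono (Finset.coe_subset.mpr h))

/-- `e₁` is a class of every level. -/
theorem e₁_mem_levelClasses (s : Finset X.gen.ι) : X.e₁ ∈ X.levelClasses s := Or.inl (by simp)

/-- `e₂` is a class of every level. -/
theorem e₂_mem_levelClasses (s : Finset X.gen.ι) : X.e₂ ∈ X.levelClasses s := Or.inl (by simp)

/-- `frob i` is a class of level `s ∋ i`. -/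
theorem frob_mem_levelClasses {s : Finset X.gen.ι} {i : X.gen.ι} (hi : i ∈ s) :
    X.frob i ∈ X.levelClasses s :=
  Or.inr ⟨i, Finset.mem_coe.mpr hi, rfl⟩

/-- **The lattice of level `s`**: the subgroup of `L` generated by `e₁, e₂, frob i (i ∈ s)`. -/
def levelLattice (s : Finset X.gen.ι) : AddSubgroup X.L := AddSubgroup.closure (X.levelClasses s)

/-- The classes of a level generate its lattice. -/
theorem levelClasses_subset_levelLattice (s : Finset X.gen.ι) :
    X.levelClasses s ⊆ X.levelLattice s :=
  AddSubgroup.subset_closure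

/-- Restriction is the inclusion: `s ⊆ t ⇒ L_s ≤ L_t`. -/
theorem levelLattice_mono {s t : Finset X.gen.ι} (h : s ⊆ t) : X.levelLattice s ≤ X.levelLattice t :=
  AddSubgroup.closure_mono (X.levelClasses_mono h)

/-- `e₁ ∈ L_s`. -/
theorem e₁_mem_levelLattice (s : Finset X.gen.ι) : X.e₁ ∈ X.levelLattice s :=
  X.levelClasses_subset_levelLattice s (X.e₁_mem_levelClasses s)

/-- `e₂ ∈ L_s`. -/
theorem e₂_mem_levelLattice (s : Finset X.gen.ι) : X.e₂ ∈ X.levelLattice s :=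
  X.levelClasses_subset_levelLattice s (X.e₂_mem_levelClasses s)

/-- `frob i ∈ L_s` for `i ∈ s`. -/
theorem frob_mem_levelLattice {s : Finset X.gen.ι} {i : X.gen.ι} (hi : i ∈ s) :
    X.frob i ∈ X.levelLattice s :=
  X.levelClasses_subset_levelLattice s (X.frob_mem_levelClasses hi)

/-- Frobenius cycles supported in `s` lie in the level-`s` lattice. -/
theorem cycle_mem_levelLattice {s : Finset X.gen.ι} (c : X.gen.ι →₀ ℤ) (hc : c.support ⊆ s) :
    X.cycle c ∈ X.levelLattice s :=
  sum_mem fun _ hi ↦ zsmul_mem (X.frob_mem_levelLattice (hc hi)) _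

/-- **Restriction map between levels** `s ⊆ t`: the inclusion of lattices `L_s →+ L_t`. -/
def levelInclusion {s t : Finset X.gen.ι} (h : s ⊆ t) : X.levelLattice s →+ X.levelLattice t :=
  AddSubgroup.inclusion (X.levelLattice_mono h)

/-- The restriction map is the identity on underlying lattice vectors. -/
@[simp] theorem coe_levelInclusion {s t : Finset X.gen.ι} (h : s ⊆ t) (x : X.levelLattice s) :
    ((X.levelInclusion h x : X.levelLattice t) : X.L) = x := rfl

/-- Restriction maps are injective. -/
theorem levelInclusion_injective {s t : Finset X.gen.ι} (h : s ⊆ t) :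
    Function.Injective (X.levelInclusion h) := by
  intro x y hxy
  apply Subtype.ext
  simpa using congr_arg (fun z : X.levelLattice t ↦ (z : X.L)) hxy

/-- Functoriality: the restriction along `s ⊆ s` is the identity. -/
theorem levelInclusion_refl (s : Finset X.gen.ι) :
    X.levelInclusion (subset_refl s) = AddMonoidHom.id _ := by
  ext
  rfl

/-- Functoriality: restrictions compose. -/
theorem levelInclusion_trans {s t u : Finset X.gen.ι} (hst : s ⊆ t) (htu : t ⊆ u) :
    (X.levelInclusion htu).comp (X.levelInclusion hst) = X.levelInclusion (hst.trans htu) := by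
  ext
  rfl

/-- The pairing restricted to a level. -/
def levelInter (s : Finset X.gen.ι) : X.levelLattice s →+ X.levelLattice s →+ ℝ :=
  (X.inter.comp (X.levelLattice s).subtype).compl₂ (X.levelLattice s).subtype

/-- The level pairing is the restriction of `X.inter`. -/
@[simp] theorem levelInter_apply (s : Finset X.gen.ι) (x y : X.levelLattice s) :
    X.levelInter s x y = X.inter x y := rfl

/-- **Compatibility of the level pairings under restriction.** -/
theorem levelInter_inclusion {s t : Finset X.gen.ι} (h : s ⊆ t) (x y : X.levelLattice s) :
    X.levelInter t (X.levelInclusion h x) (X.levelInclusion h y) = X.levelInter s x y := rfl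

/-- **The real level space** `V_s = span_ℝ {1 ⊗ x : x a class of level s} ⊂ L_ℝ`. -/
def levelSpace (s : Finset X.gen.ι) : Submodule ℝ X.Lℝ :=
  Submodule.span ℝ (X.toLℝ '' X.levelClasses s)

/-- Real level spaces are finite-dimensional. -/
instance (s : Finset X.gen.ι) : FiniteDimensional ℝ (X.levelSpace s) :=
  FiniteDimensional.span_of_finite ℝ ((X.levelClasses_finite s).image _)

/-- Real level spaces are monotone in the level. -/
theorem levelSpace_mono {s t : Finset X.gen.ι} (h : s ⊆ t) : X.levelSpace s ≤ X.levelSpace t :=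
  Submodule.span_mono (Set.image_mono (X.levelClasses_mono h))

/-- `E₁ ∈ V_s`. -/
theorem E₁_mem_levelSpace (s : Finset X.gen.ι) : X.E₁ ∈ X.levelSpace s :=
  Submodule.subset_span ⟨X.e₁, X.e₁_mem_levelClasses s, rfl⟩

/-- `E₂ ∈ V_s`. -/
theorem E₂_mem_levelSpace (s : Finset X.gen.ι) : X.E₂ ∈ X.levelSpace s :=
  Submodule.subset_span ⟨X.e₂, X.e₂_mem_levelClasses s, rfl⟩

/-- **Integral ⊂ real at each level**: the level lattice maps into the real level space. -/
theorem toLℝ_mem_levelSpace {s : Finset X.gen.ι} {x : X.L} (hx : x ∈ X.levelLattice s) :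
    X.toLℝ x ∈ X.levelSpace s := by
  have h : X.levelLattice s ≤ (X.levelSpace s).toAddSubgroup.comap X.toLℝ :=
    (AddSubgroup.closure_le _).mpr fun y hy ↦ Submodule.subset_span ⟨y, hy, rfl⟩
  exact h hx

/-- **Sylvester at every truncation level**: the real intersection form of level `s` has signature
`(1, ·)` — exactly one positive square. -/
theorem sigPos_levelSpace (s : Finset X.gen.ι) :
    sigPos (X.quadBC.restrict (X.levelSpace s)) = 1 :=
  X.sigPos_restrict_eq_one _ (add_mem (X.E₁_mem_levelSpace s) (X.E₂_mem_levelSpace s))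

/-! ## 5. Gram matrices of finite families (the level test of the carrier search) -/

section Gram

variable {κ : Type*}

/-- Gram matrix of a finite family of lattice vectors. -/
def gram (v : κ → X.L) : Matrix κ κ ℝ := Matrix.of fun k l ↦ X.inter (v k) (v l)

/-- Entries of the Gram matrix. -/
@[simp] theorem gram_apply (v : κ → X.L) (k l : κ) : X.gram v k l = X.inter (v k) (v l) := rfl

/-- Gram matrices are symmetric. -/
theorem gram_isSymm (v : κ → X.L) : (X.gram v).IsSymm :=
  Matrix.IsSymm.ext fun _ _ ↦ X.inter_comm _ _

/-- **Primitive Gram matrix**: pairings of the projections to `⟨e₁,e₂⟩^⊥`,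
`P_kl = v_k·v_l − (v_k·e₁)(v_l·e₂) − (v_k·e₂)(v_l·e₁)`.  For the Frobenius classes `frob i` of a
level its entries are the polarised prime-side data `2𝔰 − d⋆ d_u − d_u d⋆` and its diagonal is
`−Re Q(φ_i)` (`interBC_prim_cycleℝ`), so `−primGram ⪰ 0` is the windowed Weil Gram test. -/
def primGram (v : κ → X.L) : Matrix κ κ ℝ := Matrix.of fun k l ↦
  X.inter (v k) (v l) - X.inter (v k) X.e₁ * X.inter (v l) X.e₂ - X.inter (v k) X.e₂ * X.inter (v l) X.e₁

/-- Entries of the primitive Gram matrix. -/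
@[simp] theorem primGram_apply (v : κ → X.L) (k l : κ) :
    X.primGram v k l = X.inter (v k) (v l) - X.inter (v k) X.e₁ * X.inter (v l) X.e₂ -
      X.inter (v k) X.e₂ * X.inter (v l) X.e₁ := rfl

/-- Primitive Gram matrices are symmetric. -/
theorem primGram_isSymm (v : κ → X.L) : (X.primGram v).IsSymm :=
  Matrix.IsSymm.ext fun k l ↦ by
    rw [primGram_apply, primGram_apply, X.inter_comm (v l) (v k)]
    ring

/-- A primitive Gram entry is the real pairing of the primitive projections. -/
theorem primGram_eq_interBC_prim (v : κ → X.L) (k l : κ) :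
    X.primGram v k l = X.interBC (X.prim (X.toLℝ (v k))) (X.prim (X.toLℝ (v l))) := by
  have h := X.interBC_eq_prim (X.toLℝ (v k)) (X.toLℝ (v l))
  rw [interBC_toLℝ] at h
  simp only [toLℝ_apply, interBC_tmul_E₁, interBC_tmul_E₂, one_mul] at h
  rw [primGram_apply, h]
  simp only [toLℝ_apply]
  ring

/-- The quadratic form of the primitive Gram matrix is the square of a primitive real class. -/
theorem dotProduct_primGram_mulVec [Fintype κ] (v : κ → X.L) (a : κ → ℝ) :
    a ⬝ᵥ (X.primGram v *ᵥ a) =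
      X.interBC (X.prim (∑ k, a k • X.toLℝ (v k))) (X.prim (∑ k, a k • X.toLℝ (v k))) := by
  simp only [dotProduct, Matrix.mulVec, primGram_eq_interBC_prim, map_sum, map_smul,
    LinearMap.sum_apply, LinearMap.smul_apply, smul_eq_mul, Finset.mul_sum]
  exact Finset.sum_congr rfl fun k _ ↦ Finset.sum_congr rfl fun l _ ↦ by
    rw [X.interBC_comm (X.prim (X.toLℝ (v l))) (X.prim (X.toLℝ (v k)))]
    ring

/-- **The level test (Hodge index, unconstrained form)**: `−primGram ⪰ 0` for every finite family
of lattice vectors. -/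
theorem posSemidef_neg_primGram [Fintype κ] (v : κ → X.L) : (-X.primGram v).PosSemidef := by
  refine Matrix.PosSemidef.of_dotProduct_mulVec_nonneg ?_ fun a ↦ ?_
  · simpa using (X.primGram_isSymm v).neg
  · rw [Matrix.neg_mulVec, dotProduct_neg, star_trivial, dotProduct_primGram_mulVec]
    have h := X.interBC_prim_self_nonpos (∑ k, a k • X.toLℝ (v k))
    linarith

/-- The constrained form on the plain Gram matrix: `aᵀ G a ≤ 0` whenever `Σ a_k (v_k·e₁) =
Σ a_k (v_k·e₂) = 0` (the field `hodge` verbatim, for any finite index type). -/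
theorem dotProduct_gram_mulVec_nonpos [Fintype κ] (v : κ → X.L) (a : κ → ℝ)
    (h₁ : ∑ k, a k * X.inter (v k) X.e₁ = 0) (h₂ : ∑ k, a k * X.inter (v k) X.e₂ = 0) :
    a ⬝ᵥ (X.gram v *ᵥ a) ≤ 0 := by
  have h := X.hodge_fintype v a h₁ h₂
  have hre : a ⬝ᵥ (X.gram v *ᵥ a) = ∑ k, ∑ l, a k * a l * X.inter (v k) (v l) := by
    simp only [dotProduct, Matrix.mulVec, gram_apply, Finset.mul_sum]
    exact Finset.sum_congr rfl fun k _ ↦ Finset.sum_congr rfl fun l _ ↦ by ring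
  rw [hre]
  exact h

end Gram

end ArithmeticWeilSurface

end Summit.RiemannHypothesis.RiemannHypothesis.Theorems.MotivicDoor.AWS
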